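import Summits.CriticalPhenomena.PercolationContinuityZ3.Theorems.PercNearOneGluingNoHeavyLowerTailKNGoodThreeRelaysKNStrong
import HarnessLib

/-!
# `NoHeavyLowerTail` (stmt-CriticalPhenomena-4575) — Kozma–Nitzan's Theorem-2 hypothesis implies GOODNESS (symmetric form)

Support file (`--supports stmt-CriticalPhenomena-4575`, hull-port prover `prim-hp-2`, gen 23).  No new definitions, no named facts,
no sorries; standard axioms.

`KNGoodThreeKN.knGood_triple_of_KN'` is stated for a labelling `c, a, t` of the three relays with `c` the least reliable.  This file
removes the labelling: for ANY three relays `a₁, a₂, a₃` (not necessarily distinct), ANY finite weighted graph, observer `o` and target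
`b`, Kozma–Nitzan's hypothesis "`m_j ≤ m_{A∖j}` for some `j`" (arXiv:2401.12397, Thm. 2, p. 8; `m_S = P(b ↔ a_s ∀ s ∈ S, b ↮ A∖S)`)
implies that `(G, {a₁,a₂,a₃}, o, b)` is GOOD in the sense of their §3.2 — whereas their Theorem 2 asserts the (weaker) inequality (3).

* `KNGoodThreeKN.knGood_threeRelays_of_KN`.
[cite: KozmaNitzan2024, Thm. 2 (p. 8), §3.2 Definition (p. 12)]
-/

noncomputable section

namespace Summit.CriticalPhenomena.PercolationContinuityZ3.Theorems

open MeasureTheory Set Literature.Probability.LatticeModels Literature.Probability.Percolation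
open scoped Classical

namespace KNGoodThreeKN

open KNGoodAux KNGoodPocketBHK

variable {V : Type*} [Fintype V]

/-- Goodness does not depend on how the relay set is written. [folklore] -/
theorem knGood_congr {w : Sym2 V → unitInterval} {A A' : Finset V} (h : A = A') (hA : A.Nonempty)
    (hA' : A'.Nonempty) (o b : V) : KNGood w A hA o b ↔ KNGood w A' hA' o b := by
  subst h; exact Iff.rfl

/-- **Kozma–Nitzan's Theorem-2 hypothesis implies goodness (three relays, every graph).**  For any finite weighted graph, observer
`o`, target `b` and relays `a₁, a₂, a₃`: if `m_j ≤ m_{A∖{j}}` for some `j` — i.e.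
`P(a_j↔b, b↮ the other two) ≤ P(b ↔ both others, b↮a_j)` — then `(G, {a₁,a₂,a₃}, o, b)` is good.
[cite: KozmaNitzan2024, Thm. 2 (p. 8), §3.2 Definition (p. 12)] -/
theorem knGood_threeRelays_of_KN (w : Sym2 V → unitInterval) (o b a₁ a₂ a₃ : V)
    (hj : (prodBernoulli w).real (openConn a₁ b ∩ (openConn a₂ b)ᶜ ∩ (openConn a₃ b)ᶜ) ≤
        (prodBernoulli w).real (openConn a₂ b ∩ openConn a₃ b ∩ (openConn a₁ b)ᶜ) ∨
      (prodBernoulli w).real (openConn a₂ b ∩ (openConn a₁ b)ᶜ ∩ (openConn a₃ b)ᶜ) ≤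
        (prodBernoulli w).real (openConn a₁ b ∩ openConn a₃ b ∩ (openConn a₂ b)ᶜ) ∨
      (prodBernoulli w).real (openConn a₃ b ∩ (openConn a₁ b)ᶜ ∩ (openConn a₂ b)ᶜ) ≤
        (prodBernoulli w).real (openConn a₁ b ∩ openConn a₂ b ∩ (openConn a₃ b)ᶜ)) :
    KNGood w ({a₁, a₂, a₃} : Finset V) (Finset.insert_nonempty a₁ {a₂, a₃}) o b := by
  classical
  -- which relay is the least reliable?
  rcases le_total ((prodBernoulli w).real (openConn a₁ b)) ((prodBernoulli w).real (openConn a₂ b)) with h12 | h21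
  · rcases le_total ((prodBernoulli w).real (openConn a₁ b)) ((prodBernoulli w).real (openConn a₃ b)) with h13 | h31
    · -- c = a₁, a = a₂, t = a₃
      refine knGood_triple_of_KN' w o b a₁ a₂ a₃ h12 h13 ?_
      rcases hj with h | h | h
      · exact Or.inl (by simpa only [Set.inter_assoc, Set.inter_comm, Set.inter_left_comm] using h)
      · exact Or.inr (Or.inl (by simpa only [Set.inter_assoc, Set.inter_comm, Set.inter_left_comm] using h))
      · exact Or.inr (Or.inr (by simpa only [Set.inter_assoc, Set.inter_comm, Set.inter_left_comm] using h))
    · -- c = a₃, a = a₁, t = a₂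
      have h32 : (prodBernoulli w).real (openConn a₃ b) ≤ (prodBernoulli w).real (openConn a₂ b) := h31.trans h12
      have hg : KNGood w ({a₃, a₁, a₂} : Finset V) (Finset.insert_nonempty a₃ {a₁, a₂}) o b := by
        refine knGood_triple_of_KN' w o b a₃ a₁ a₂ h31 h32 ?_
        rcases hj with h | h | h
        · exact Or.inr (Or.inl (by simpa only [Set.inter_assoc, Set.inter_comm, Set.inter_left_comm] using h))
        · exact Or.inr (Or.inr (by simpa only [Set.inter_assoc, Set.inter_comm, Set.inter_left_comm] using h))
        · exact Or.inl (by simpa only [Set.inter_assoc, Set.inter_comm, Set.inter_left_comm] using h)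
      have e : ({a₃, a₁, a₂} : Finset V) = {a₁, a₂, a₃} := by
        ext x; simp only [Finset.mem_insert, Finset.mem_singleton]; tauto
      exact (knGood_congr e _ (Finset.insert_nonempty a₁ {a₂, a₃}) o b).1 hg
  · rcases le_total ((prodBernoulli w).real (openConn a₂ b)) ((prodBernoulli w).real (openConn a₃ b)) with h23 | h32
    · -- c = a₂, a = a₁, t = a₃
      have hg : KNGood w ({a₂, a₁, a₃} : Finset V) (Finset.insert_nonempty a₂ {a₁, a₃}) o b := by
        refine knGood_triple_of_KN' w o b a₂ a₁ a₃ h21 h23 ?_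
        rcases hj with h | h | h
        · exact Or.inr (Or.inl (by simpa only [Set.inter_assoc, Set.inter_comm, Set.inter_left_comm] using h))
        · exact Or.inl (by simpa only [Set.inter_assoc, Set.inter_comm, Set.inter_left_comm] using h)
        · exact Or.inr (Or.inr (by simpa only [Set.inter_assoc, Set.inter_comm, Set.inter_left_comm] using h))
      have e : ({a₂, a₁, a₃} : Finset V) = {a₁, a₂, a₃} := by
        ext x; simp only [Finset.mem_insert, Finset.mem_singleton]; tauto
      exact (knGood_congr e _ (Finset.insert_nonempty a₁ {a₂, a₃}) o b).1 hg
    · -- c = a₃, a = a₁, t = a₂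
      have h31 : (prodBernoulli w).real (openConn a₃ b) ≤ (prodBernoulli w).real (openConn a₁ b) := h32.trans h21
      have hg : KNGood w ({a₃, a₁, a₂} : Finset V) (Finset.insert_nonempty a₃ {a₁, a₂}) o b := by
        refine knGood_triple_of_KN' w o b a₃ a₁ a₂ h31 h32 ?_
        rcases hj with h | h | h
        · exact Or.inr (Or.inl (by simpa only [Set.inter_assoc, Set.inter_comm, Set.inter_left_comm] using h))
        · exact Or.inr (Or.inr (by simpa only [Set.inter_assoc, Set.inter_comm, Set.inter_left_comm] using h))
        · exact Or.inl (by simpa only [Set.inter_assoc, Set.inter_comm, Set.inter_left_comm] using h)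
      have e : ({a₃, a₁, a₂} : Finset V) = {a₁, a₂, a₃} := by
        ext x; simp only [Finset.mem_insert, Finset.mem_singleton]; tauto
      exact (knGood_congr e _ (Finset.insert_nonempty a₁ {a₂, a₃}) o b).1 hg

end KNGoodThreeKN

end Summit.CriticalPhenomena.PercolationContinuityZ3.Theorems
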